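import Literature.NumberTheory.Automorphic.BlockDiagonalLieAlgebra
import Literature.NumberTheory.Automorphic.LieAlgebraGLBracket
import Literature.NumberTheory.Automorphic.LieAlgebraGLDimension
import Literature.Algebra.Lie.SpecialLinearSimple
import HarnessLib

/-!
# Goursat–Kolchin–Ribet, Lie-algebra steps: the block projections of `Lie(G°)` contain `𝔰𝔩(Eᵢ)`,
# `dim 𝔰𝔩ₙ = n² − 1`, reindexing `𝔰𝔩`, and Schur's lemma for an equivariant `Ad(A)` (Katz 1990, proof of
# Prop. 1.8.2: "it suffices to prove that `Lie(G) = Π Lie(Gᵢ)`")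

Layer `Literature/AlgebraicGeometry/HodgeTheory` (companion of `GoursatKolchinRibetCriterion`,
`GoursatKolchinRibetKernels`, `GoursatKolchinRibetTwist`), MATRIX side: `Δ ≤ GL(⊕ᵢ k^{mᵢ})` a group of
block-diagonal matrices, `L` a block-diagonal algebraic subgroup (in the application
`L = (Δ^Zar)° = identityComponent (zariskiClosure Δ)`), `Lie(L) = lieAlgebraGL L ⊆ 𝔤𝔩` its Lie algebra
(`Literature/NumberTheory/Automorphic`). THEOREMS only:

* §1 `conj_mem_lieAlgebraGL_identityComponent_zariskiClosure` — `Lie((Δ^Zar)°)` is `Ad(Δ)`-stable; blocks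
  of commutators and of conjugates of block-diagonal matrices.
* §2 **`exists_mem_lieAlgebraGL_traceless_blockDiag_eq`** — if every determinant-one `u ∈ SL(mᵢ)` is the
  `i`-th block of an element of `L` (Katz's "`G°` maps onto `Gᵢ° ⊇ Gᵢ^{0,der} = SL`", hypothesis (1) in lift
  form) then every traceless `Y ∈ 𝔰𝔩(mᵢ)` is the `i`-th block of an element of `Lie(L)` ALL of whose blocks
  are traceless ("`pᵢ(Lie G ∩ ⊕ 𝔰𝔩ⱼ) = 𝔰𝔩ᵢ = Lie(Gᵢ^{0,der})`"): logarithms of lifted transvections give the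
  `E_{ab}` (`BlockDiagonalLieAlgebra.exists_mem_lieAlgebraGL_blockDiag_eq_sub_one`), their brackets the
  `H_{ab}` and again the `E_{ab}` with traceless companions, and these span `𝔰𝔩` (Humphreys §1.2).
* §3 `finrank_sl` (`dim 𝔰𝔩ₙ = n² − 1`), `exists_lieHom_sl_reindex` (reindexing `𝔰𝔩ₙ ≅ 𝔰𝔩ₙ'` along
  `n ≃ n'` as a bijective Lie homomorphism), `trace_submatrix_equiv`.
* §4 `exists_smul_of_conj_eq`, `exists_smul_of_conj_transpose_eq` — Schur: if `Ad(A⁻¹)` (resp.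
  `−Ad(A⁻¹)∘ᵀ`) intertwines `Ad(S')` on `𝔰𝔩` with `Ad(S)`, then `A⁻¹S' = c·SA⁻¹` (resp. `A⁻¹S'⁻ᵀ = c·SA⁻¹`)
  — the matrix form of `GoursatKolchinRibetTwist`.

Consumer: `GoursatKolchinRibetLieCore` (the Goursat core of `Katz1990_goursatKolchinRibet_specialLinear'`,
crux K1 of `Summits/HodgeConjecture/HodgeConjecture/Theses/CyclicUnitaryPowers.lean`, cell `hodge-nonav`).
Written by the prover seat `hodge-nonav-prover-Ax`.

## References
* [Katz1990ESDE] N. M. Katz, *Exponential Sums and Differential Equations* (1990), §1.8, proof of Prop. 1.8.2.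
* [Humphreys1972] J. E. Humphreys, *Introduction to Lie Algebras and Representation Theory* (1972), §1.2.
* [SpringerLAG1998] T. A. Springer, *Linear Algebraic Groups*, 2nd ed. (1998), 4.4.5, 4.4.6.
-/

noncomputable section

open scoped MatrixGroups

namespace Literature.AlgebraicGeometry.HodgeTheory

open Matrix Module Literature.NumberTheory.Automorphic LieAlgebra LieAlgebra.SpecialLinear

/-! ### §1 `Ad(Δ)`-stability and blocks of commutators / conjugates -/

section Ad

variable {k : Type*} [Field k] {n : Type*} [Fintype n] [DecidableEq n]

/-- **`Lie((Δ^Zar)°)` is `Ad(Δ)`-stable**: for `δ ∈ Δ` and `X ∈ Lie(identityComponent (zariskiClosure Δ))`,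
`δ X δ⁻¹` lies there too (`Lie(H°) = Lie(H)`, Springer 4.4.6, and `Ad(H)`-stability of `Lie(H)`, 4.4.5).
[cite: SpringerLAG1998, 4.4.5 and 4.4.6] -/
theorem conj_mem_lieAlgebraGL_identityComponent_zariskiClosure {Δ : Subgroup (GL n k)} {δ : GL n k}
    (hδ : δ ∈ Δ) {X : Matrix n n k} (hX : X ∈ lieAlgebraGL (identityComponent (zariskiClosure Δ))) :
    (δ : Matrix n n k) * X * ((δ⁻¹ : GL n k) : Matrix n n k) ∈ lieAlgebraGL (identityComponent (zariskiClosure Δ)) := by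
  rw [lieAlgebraGL_identityComponent (isAlgebraicSubgroup_zariskiClosure Δ)] at hX ⊢
  exact conj_mem_lieAlgebraGL (le_zariskiClosure Δ hδ) hX

end Ad

section Blocks

variable {k : Type*} [Field k] {ι : Type*} [Fintype ι] [DecidableEq ι] {m : ι → Type*}
  [∀ i, Fintype (m i)] [∀ i, DecidableEq (m i)]

omit [DecidableEq ι] [∀ i, DecidableEq (m i)] in
/-- Blocks of a commutator of block-diagonal matrices: `[X, Y]ᵢ = [Xᵢ, Yᵢ]`. [cite: Katz1990ESDE, §1.8 Prop. 1.8.2 (proof)] -/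
theorem blockDiag'_commutator {X Y : Matrix (Σ i, m i) (Σ i, m i) k}
    (hX : ∀ a b : Σ i, m i, a.1 ≠ b.1 → X a b = 0) (hY : ∀ a b : Σ i, m i, a.1 ≠ b.1 → Y a b = 0) (i : ι) :
    blockDiag' (X * Y - Y * X) i = blockDiag' X i * blockDiag' Y i - blockDiag' Y i * blockDiag' X i := by
  rw [blockDiag'_sub, Pi.sub_apply, blockDiag'_mul_of_offDiag hX, blockDiag'_mul_of_offDiag hY]

omit [DecidableEq ι] [∀ i, DecidableEq (m i)] in
/-- The blocks of a commutator of block-diagonal matrices are traceless. [cite: Katz1990ESDE, §1.8 Prop. 1.8.2 (proof)] -/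
theorem trace_blockDiag'_commutator {X Y : Matrix (Σ i, m i) (Σ i, m i) k}
    (hX : ∀ a b : Σ i, m i, a.1 ≠ b.1 → X a b = 0) (hY : ∀ a b : Σ i, m i, a.1 ≠ b.1 → Y a b = 0) (i : ι) :
    (blockDiag' (X * Y - Y * X) i).trace = 0 := by
  rw [blockDiag'_commutator hX hY, trace_sub, trace_mul_comm, sub_self]

/-- Blocks of a conjugate `δ X δ⁻¹` (`δ ∈ GL` and `X` block diagonal): `(δ X δ⁻¹)ᵢ = δᵢ Xᵢ δᵢ⁻¹`.
[cite: Katz1990ESDE, §1.8 Prop. 1.8.2 (proof)] -/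
theorem blockDiag'_conj {δ : GL (Σ i, m i) k}
    (hδ : ∀ a b : Σ i, m i, a.1 ≠ b.1 → (δ : Matrix (Σ i, m i) (Σ i, m i) k) a b = 0)
    {X : Matrix (Σ i, m i) (Σ i, m i) k} (hX : ∀ a b : Σ i, m i, a.1 ≠ b.1 → X a b = 0) (i : ι) :
    blockDiag' ((δ : Matrix (Σ i, m i) (Σ i, m i) k) * X * ((δ⁻¹ : GL (Σ i, m i) k) : Matrix (Σ i, m i) (Σ i, m i) k)) i =
      blockDiag' (δ : Matrix (Σ i, m i) (Σ i, m i) k) i * blockDiag' X i *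
        (blockDiag' (δ : Matrix (Σ i, m i) (Σ i, m i) k) i)⁻¹ := by
  rw [blockDiag'_mul_of_offDiag (offDiag_mul_eq_zero hδ hX), blockDiag'_mul_of_offDiag hδ, blockDiag'_coe_inv hδ]

/-- Conjugation preserves the traces of the blocks: `tr (δ X δ⁻¹)ᵢ = tr Xᵢ`. [cite: Katz1990ESDE, §1.8 Prop. 1.8.2 (proof)] -/
theorem trace_blockDiag'_conj {δ : GL (Σ i, m i) k}
    (hδ : ∀ a b : Σ i, m i, a.1 ≠ b.1 → (δ : Matrix (Σ i, m i) (Σ i, m i) k) a b = 0)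
    {X : Matrix (Σ i, m i) (Σ i, m i) k} (hX : ∀ a b : Σ i, m i, a.1 ≠ b.1 → X a b = 0) (i : ι) :
    (blockDiag' ((δ : Matrix (Σ i, m i) (Σ i, m i) k) * X *
        ((δ⁻¹ : GL (Σ i, m i) k) : Matrix (Σ i, m i) (Σ i, m i) k)) i).trace = (blockDiag' X i).trace := by
  rw [blockDiag'_conj hδ hX, trace_mul_cycle,
    nonsing_inv_mul _ ((isUnit_iff_ne_zero).2 (det_blockDiag'_ne_zero hδ i)), one_mul]

/-! ### §2 The traceless part of `Lie(L)` projects onto each `𝔰𝔩(mᵢ)` -/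

/-- **`pᵢ(Lie(L) ∩ ⊕ⱼ 𝔰𝔩ⱼ) ⊇ 𝔰𝔩(mᵢ)`** (Katz, proof of 1.8.2: `Lie(G) → Lie(Gᵢ)` is onto and
`Lie(Gᵢ^{0,der}) = 𝔰𝔩(Vᵢ)`; here from hypothesis (1) in lift form, for `k` algebraically closed of
characteristic `0`, `L ≤ GL(⊕ k^{mⱼ})` algebraic and block diagonal, `|mᵢ| ≥ 2`): if every `u ∈ SL(mᵢ)` is
the `i`-th block of an element of `L`, then every traceless `Y` is the `i`-th block of some `X ∈ Lie(L)` all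
of whose blocks are traceless. The `E_{ab}` (`a ≠ b`) are blocks of logarithms of lifted transvections
(`exists_mem_lieAlgebraGL_blockDiag_eq_sub_one`); `[X^{ba}, X^{ab}]` has blocks `[·,·]` (traceless) and
`i`-th block `E_{bb} − E_{aa}`; bracketing once more gives `−2E_{ba}`; these span `𝔰𝔩`
(`eq_sum_units_of_trace_eq_zero`). [cite: Katz1990ESDE, §1.8 Prop. 1.8.2 (proof)] [cite: Humphreys1972, §1.2] -/
theorem exists_mem_lieAlgebraGL_traceless_blockDiag_eq [IsAlgClosed k] [CharZero k] {L : Subgroup (GL (Σ i, m i) k)}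
    (hLalg : IsAlgebraicSubgroup L)
    (hL : ∀ g ∈ L, ∀ a b : Σ i, m i, a.1 ≠ b.1 → (g : Matrix (Σ i, m i) (Σ i, m i) k) a b = 0)
    (i : ι) (hi : 2 ≤ Fintype.card (m i))
    (h1 : ∀ u : Matrix (m i) (m i) k, u.det = 1 → ∃ g ∈ L, blockDiag' (g : Matrix (Σ i, m i) (Σ i, m i) k) i = u)
    {Y : Matrix (m i) (m i) k} (hY : Y.trace = 0) :
    ∃ X ∈ lieAlgebraGL L, (∀ j, (blockDiag' X j).trace = 0) ∧ blockDiag' X i = Y := by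
  classical
  have hbd : ∀ {X : Matrix (Σ i, m i) (Σ i, m i) k}, X ∈ lieAlgebraGL L →
      ∀ a b : Σ i, m i, a.1 ≠ b.1 → X a b = 0 := fun hX => offDiag_eq_zero_of_mem_lieAlgebraGL hL hX
  -- the property "is the `i`-th block of a block-traceless element of `Lie(L)`"
  set P : Matrix (m i) (m i) k → Prop := fun Y =>
    ∃ X ∈ lieAlgebraGL L, (∀ j, (blockDiag' X j).trace = 0) ∧ blockDiag' X i = Y with hP
  have hP0 : P 0 := ⟨0, Submodule.zero_mem _, fun j => by rw [blockDiag'_zero, Pi.zero_apply, trace_zero], by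
    rw [blockDiag'_zero, Pi.zero_apply]⟩
  have hPadd : ∀ Y Y', P Y → P Y' → P (Y + Y') := by
    rintro Y Y' ⟨X, hX, hXt, rfl⟩ ⟨X', hX', hX't, rfl⟩
    refine ⟨X + X', Submodule.add_mem _ hX hX', fun j => ?_, ?_⟩
    · rw [blockDiag'_add, Pi.add_apply, trace_add, hXt, hX't, add_zero]
    · rw [blockDiag'_add, Pi.add_apply]
  have hPsmul : ∀ (c : k) Y, P Y → P (c • Y) := by
    rintro c Y ⟨X, hX, hXt, rfl⟩
    refine ⟨c • X, Submodule.smul_mem _ c hX, fun j => ?_, ?_⟩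
    · rw [blockDiag'_smul, Pi.smul_apply, trace_smul, hXt, smul_zero]
    · rw [blockDiag'_smul, Pi.smul_apply]
  -- the commutator of two elements of `Lie(L)` is block traceless
  have hPcomm : ∀ {X X' : Matrix (Σ i, m i) (Σ i, m i) k}, X ∈ lieAlgebraGL L → X' ∈ lieAlgebraGL L →
      P (blockDiag' X i * blockDiag' X' i - blockDiag' X' i * blockDiag' X i) := by
    intro X X' hX hX'
    refine ⟨X * X' - X' * X, lie_mem_lieAlgebraGL hX hX', fun j => trace_blockDiag'_commutator (hbd hX) (hbd hX') j, ?_⟩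
    rw [blockDiag'_commutator (hbd hX) (hbd hX')]
  -- (1) the `E_{ab}`, `a ≠ b`, are `i`-th blocks of elements of `Lie(L)` (logarithms of lifted transvections)
  have hE : ∀ a b : m i, a ≠ b → ∃ X ∈ lieAlgebraGL L, blockDiag' X i = single a b (1 : k) := by
    intro a b hab
    have hu : (transvection a b (1 : k) - 1) * (transvection a b 1 - 1) = 0 := by
      rw [transvection, add_sub_cancel_left, single_mul_single_of_ne (1 : k) a b a hab.symm 1]
    obtain ⟨X, hX, hXi⟩ := exists_mem_lieAlgebraGL_blockDiag_eq_sub_one hLalg hL i hi hu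
      (h1 _ (det_transvection_of_ne a b hab 1))
    exact ⟨X, hX, by rw [hXi, transvection, add_sub_cancel_left]⟩
  -- (2) `H_{ba} = E_{bb} − E_{aa}` and (3) `E_{ba}` with block-traceless companions
  have hH : ∀ a b : m i, a ≠ b → P (single b b (1 : k) - single a a 1) := by
    intro a b hab
    obtain ⟨X, hX, hXi⟩ := hE a b hab
    obtain ⟨X', hX', hX'i⟩ := hE b a hab.symm
    have h := hPcomm hX' hX
    rwa [hXi, hX'i, Literature.Algebra.Lie.SpecialLinearSimple.single_comm_single_transpose] at h
  have hE' : ∀ a b : m i, a ≠ b → P (single b a (1 : k)) := by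
    intro a b hab
    obtain ⟨X', hX', hX'i⟩ := hE b a hab.symm
    obtain ⟨XH, hXH, hXHt, hXHi⟩ := hH a b hab
    have h := hPcomm hX' hXH
    rw [hX'i, hXHi, Literature.Algebra.Lie.SpecialLinearSimple.single_comm_diag hab] at h
    have h2 := hPsmul (-2 : k)⁻¹ _ h
    rwa [smul_smul, inv_mul_cancel₀ (neg_ne_zero.2 (two_ne_zero' k)), one_smul] at h2
  -- (4) span
  obtain ⟨k₀, -⟩ : ∃ a b : m i, a ≠ b := Fintype.exists_pair_of_one_lt_card hi
  rw [Literature.Algebra.Lie.SpecialLinearSimple.eq_sum_units_of_trace_eq_zero k₀ hY]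
  refine Finset.sum_induction _ P hPadd hP0 fun a _ => Finset.sum_induction _ P hPadd hP0 fun b _ => hPsmul _ _ ?_
  split_ifs with hab
  · subst hab
    by_cases hak : a = k₀
    · subst hak
      rw [sub_self]
      exact hP0
    · exact hH k₀ a (Ne.symm hak)
  · exact hE' b a (Ne.symm hab)

end Blocks

/-! ### §3 `dim 𝔰𝔩ₙ = n² − 1`, traces of reindexed matrices, reindexing `𝔰𝔩` -/

section SpecialLinear

variable {k : Type*} [Field k] {n n' : Type*} [Fintype n] [DecidableEq n] [Fintype n'] [DecidableEq n']

omit [DecidableEq n] [DecidableEq n'] in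
/-- `tr (M.submatrix e e) = tr M` for an equivalence `e`. [cite: Humphreys1972, §1.2] -/
theorem trace_submatrix_equiv (M : Matrix n n k) (e : n' ≃ n) : (M.submatrix e e).trace = M.trace := by
  simp only [Matrix.trace, Matrix.diag, submatrix_apply]
  exact e.sum_comp (fun a => M a a)

/-- **`dim 𝔰𝔩ₙ = n² − 1`** (`𝔰𝔩ₙ` is the kernel of the trace, a non-zero linear form on the `n²`-dimensional
space of matrices; `n` non-empty). [cite: Humphreys1972, §1.2] -/
theorem finrank_sl [Nonempty n] : finrank k (sl n k) = Fintype.card n ^ 2 - 1 := by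
  obtain ⟨a⟩ := ‹Nonempty n›
  have hsurj : Function.Surjective (Matrix.traceLinearMap n k k) := fun c =>
    ⟨c • single a a 1, by rw [map_smul, Matrix.traceLinearMap_apply, trace_single_eq_same, smul_eq_mul, mul_one]⟩
  have h := LinearMap.finrank_range_add_finrank_ker (Matrix.traceLinearMap n k k)
  rw [LinearMap.range_eq_top.2 hsurj, finrank_top, Module.finrank_self, Module.finrank_matrix,
    Module.finrank_self, mul_one] at h
  change finrank k (LinearMap.ker (Matrix.traceLinearMap n k k)) = _
  rw [pow_two]
  omega

/-- **Reindexing `𝔰𝔩` along `e : n ≃ n'`** is a bijective Lie algebra homomorphism `𝔰𝔩ₙ' → 𝔰𝔩ₙ`,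
`X ↦ X.submatrix e e = reindex e⁻¹ e⁻¹ X` (an existence statement, so that no definition is introduced).
[cite: Humphreys1972, §1.2] -/
theorem exists_lieHom_sl_reindex (e : n ≃ n') :
    ∃ ρ : sl n' k →ₗ⁅k⁆ sl n k, Function.Bijective ρ ∧
      ∀ X : sl n' k, ((ρ X : sl n k) : Matrix n n k) = (X : Matrix n' n' k).submatrix e e := by
  -- the commutator Lie ring structure on matrices (Mathlib's non-instance `LieRing.ofAssociativeRing`, the one
  -- carried by `sl`), needed to speak of `⁅X, Y⁆` for matrices inside this proof
  letI : LieRing (Matrix n' n' k) := LieRing.ofAssociativeRing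
  have hmem : ∀ X : sl n' k, (X : Matrix n' n' k).submatrix e e ∈ sl n k := fun X => by
    change Matrix.trace _ = 0
    rw [trace_submatrix_equiv]
    exact X.2
  let ρ : sl n' k →ₗ⁅k⁆ sl n k :=
    { toFun := fun X => ⟨(X : Matrix n' n' k).submatrix e e, hmem X⟩
      map_add' := fun X Y => Subtype.ext (by simp [submatrix_add])
      map_smul' := fun c X => Subtype.ext (by simp [submatrix_smul])
      map_lie' := by
        intro X Y
        apply Subtype.ext
        change ((⁅X, Y⁆ : sl n' k) : Matrix n' n' k).submatrix e e =
          (X : Matrix n' n' k).submatrix e e * (Y : Matrix n' n' k).submatrix e e -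
            (Y : Matrix n' n' k).submatrix e e * (X : Matrix n' n' k).submatrix e e
        rw [LieSubalgebra.coe_bracket, Ring.lie_def, submatrix_sub, Pi.sub_apply, Pi.sub_apply, submatrix_mul_equiv,
          submatrix_mul_equiv] }
  refine ⟨ρ, ⟨fun X Y h => ?_, fun Y => ?_⟩, fun X => rfl⟩
  · apply Subtype.ext
    have h' : (X : Matrix n' n' k).submatrix e e = (Y : Matrix n' n' k).submatrix e e := congrArg Subtype.val h
    have h'' := congrArg (fun M : Matrix n n k => M.submatrix e.symm e.symm) h'
    simp only [submatrix_submatrix, Equiv.self_comp_symm, submatrix_id_id] at h''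
    exact h''
  · refine ⟨⟨(Y : Matrix n n k).submatrix e.symm e.symm, ?_⟩, Subtype.ext ?_⟩
    · change Matrix.trace _ = 0
      rw [trace_submatrix_equiv]
      exact Y.2
    · change ((Y : Matrix n n k).submatrix e.symm e.symm).submatrix e e = Y
      simp only [submatrix_submatrix, Equiv.symm_comp_self, submatrix_id_id]

end SpecialLinear

/-! ### §4 Schur's lemma for an equivariant `Ad(A)`, matrix form -/

section Schur

variable {k : Type*} [Field k] {n : Type*} [Fintype n] [DecidableEq n]

/-- A matrix commuting with every traceless matrix is a scalar (it commutes with the `E_{ab}`, `a ≠ b`;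
Mathlib `Matrix.mem_range_scalar_of_commute_single`). [cite: Katz1990ESDE, §1.8 Prop. 1.8.2 (proof, last paragraph)] -/
theorem exists_eq_scalar_of_forall_traceless_commute {C : Matrix n n k}
    (hC : ∀ Z : Matrix n n k, Z.trace = 0 → C * Z = Z * C) : ∃ c : k, C = c • (1 : Matrix n n k) := by
  have hcomm : Pairwise fun a b => Commute (single a b (1 : k)) C := fun a b hab =>
    (hC _ (trace_single_eq_of_ne a b (1 : k) hab)).symm
  obtain ⟨c, hc⟩ := mem_range_scalar_of_commute_single hcomm
  exact ⟨c, by rw [← hc, scalar_apply, smul_one_eq_diagonal]⟩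

/-- **Schur for an equivariant `Ad(A⁻¹)`** (Katz: the graph is "`g ↦ AgA⁻¹`", so `ρᵢ ≅ χ ⊗ ρⱼ`): if
`A⁻¹ (S' Z S'⁻¹) A = S (A⁻¹ Z A) S⁻¹` for every traceless `Z` (`A, S, S'` invertible), then
`A⁻¹ S' = c · S A⁻¹` for a scalar `c` — `A S⁻¹ A⁻¹ S'` commutes with every traceless `Z`.
[cite: Katz1990ESDE, §1.8 Prop. 1.8.2 (proof, last paragraph)] -/
theorem exists_smul_of_conj_eq {A S S' : Matrix n n k} (hA : IsUnit A.det) (hS : IsUnit S.det) (hS' : IsUnit S'.det)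
    (h : ∀ Z : Matrix n n k, Z.trace = 0 → A⁻¹ * (S' * Z * S'⁻¹) * A = S * (A⁻¹ * Z * A) * S⁻¹) :
    ∃ c : k, A⁻¹ * S' = c • (S * A⁻¹) := by
  have hC : ∀ Z : Matrix n n k, Z.trace = 0 → (A * S⁻¹ * A⁻¹ * S') * Z = Z * (A * S⁻¹ * A⁻¹ * S') := by
    intro Z hZ
    have h1 := congrArg (fun M => A * S⁻¹ * A⁻¹ * (A * M * A⁻¹) * S') (h Z hZ)
    simp only [Matrix.mul_assoc, mul_nonsing_inv_cancel_left _ _ hA, nonsing_inv_mul_cancel_left _ _ hA,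
      nonsing_inv_mul_cancel_left _ _ hS, mul_nonsing_inv _ hA, nonsing_inv_mul _ hS', Matrix.mul_one] at h1
    simpa only [Matrix.mul_assoc] using h1
  obtain ⟨c, hc⟩ := exists_eq_scalar_of_forall_traceless_commute hC
  refine ⟨c, ?_⟩
  have h2 := congrArg (fun M => S * A⁻¹ * M) hc
  simp only [Matrix.mul_assoc, nonsing_inv_mul_cancel_left _ _ hA, mul_nonsing_inv_cancel_left _ _ hS,
    Matrix.mul_smul, Matrix.mul_one] at h2
  simpa only [Matrix.mul_assoc] using h2

omit [DecidableEq n] in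
/-- Transposition preserves tracelessness. [cite: Katz1990ESDE, §1.8 Prop. 1.8.2 (proof, last paragraph)] -/
private theorem trace_transpose_eq_zero {Z : Matrix n n k} (hZ : Z.trace = 0) : Zᵀ.trace = 0 := by
  rw [trace_transpose, hZ]

/-- **Schur for an equivariant `−Ad(A⁻¹) ∘ transpose`** (Katz: the graph is "`g ↦ Ag^{−t}A⁻¹`", so
`ρᵢ^∨ ≅ χ ⊗ ρⱼ`): if `−A⁻¹ (S' Z S'⁻¹)ᵀ A = S (−A⁻¹ Zᵀ A) S⁻¹` for every traceless `Z`, then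
`A⁻¹ (S'ᵀ)⁻¹ = c · S A⁻¹` for a scalar `c`. [cite: Katz1990ESDE, §1.8 Prop. 1.8.2 (proof, last paragraph)] -/
theorem exists_smul_of_conj_transpose_eq {A S S' : Matrix n n k} (hA : IsUnit A.det) (hS : IsUnit S.det)
    (hS' : IsUnit S'.det)
    (h : ∀ Z : Matrix n n k, Z.trace = 0 → -(A⁻¹ * (S' * Z * S'⁻¹)ᵀ * A) = S * (-(A⁻¹ * Zᵀ * A)) * S⁻¹) :
    ∃ c : k, A⁻¹ * (S'ᵀ)⁻¹ = c • (S * A⁻¹) := by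
  have hS't : IsUnit S'ᵀ.det := by rwa [det_transpose]
  have hS'' : IsUnit (S'ᵀ)⁻¹.det := by
    rw [det_nonsing_inv, isUnit_ringInverse]
    exact hS't
  refine exists_smul_of_conj_eq hA hS hS'' fun W hW => ?_
  have h1 := h Wᵀ (trace_transpose_eq_zero hW)
  rw [Matrix.mul_neg, Matrix.neg_mul, neg_inj, transpose_mul, transpose_mul, transpose_transpose,
    transpose_nonsing_inv, ← Matrix.mul_assoc] at h1
  rw [nonsing_inv_nonsing_inv _ hS't]
  simpa only [Matrix.mul_assoc] using h1

end Schur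

end Literature.AlgebraicGeometry.HodgeTheory

end
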